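import Summits.KontsevichZagierPeriods.Zeta5Search.Barrier.ConeGammaRates
import Literature.NumberTheory.Transcendental.ZetaLinearFormsCriterion
import HarnessLib

/-!
# ζ(5) search — BARRIER (i): the accounting rungs (28)/(30) as NAMED HYPOTHESES and the exponent they buy

HONEST FRAMING (cell `pub-zeta5`): systematic search; no irrationality claim unless kernel-certified. Everything here is the
MODEL — closed-form rates under Brown–Zudilin's own denominator accounting ((28) is an «experimental observation» of
[BZ22] = arXiv:2210.03391, p. 20; (29)–(30) rides on it); nothing is a theorem about `ζ(5)`; every `γ` the cell has
computed is `< 1` (no irrationality content); records in print UNMOVED. A «barrier» is a statement about a METHOD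
CLASS (BZ's 8-fold cellular box with lcm-type denominator laws), CONDITIONAL on NAMED accounting hypotheses — not a
theorem that `ζ(5)`-approximations cannot exist. Sources: census kernel `census_bz_gamma.py` (sha256 8972266e…) as
transcribed in the cell's `BARRIER-FORMULAS.md` (c7e5c80b…); coordinator's REFINED STRUCTURE TARGET 2026-08-23,
clause (i) «formalise γ(direction)»; cell file `BARRIER-PLAN.md` §1 (theory seat cert-2 g16).

This file (3/5), integer directions `a : Fin 8 → ℤ`: `scaleDir`, `mIdx` (sorted multiset), `D28 a n = d_{m₁n}⋯d_{m₅n}`,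
`PhiN a n = Φ_n(a)`, `IsZeta5Part a P` (the rational parts in the shape of `BrownZudilin2022.decomposition`; BZ print
no formula for `P`; the cell's determinant dictionary is NOT used), the NAMED HYPOTHESES `Law28 a P` (BZ (28):
`D_n·P ∈ ℤ`) and `Law30 a P` ((30): `Φ_n⁻¹D_n·Q ∈ ℤ ∧ Φ_n⁻¹D_n·P ∈ ℤ`), `law28_of_law30`; the two ANALYTIC
identifications `RatesIdentified` (BZ §5 recipe, Poincaré–Perron type; not proved in the tree) and `DenominatorRate`
(`(1/n) log(D_n/Φ_n) → δ₂₈ − Φ`; its `D_n` half IS the prime number theorem: `tendsto_log_D28_div`; the `Φ_n` half —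
PNT with breakpoints, cf. `RhinViola.tendsto_log_classPrimeProduct_div` — is not proved here); `approxQ`, `approxP`,
`approx_int`; `gamma_eq_worthiness`; **`exponent_of_accounting`** — under these hypotheses BZ's worthiness recipe
(`BrownZudilin2022.abs_sub_div_lt_of_rates`) gives `|ζ(5) − p_n/q_n| < q_n^{−(γ(a) − ε)}` eventually for the integers
`p_n = Φ_n⁻¹D_nP_n`, `q_n = Φ_n⁻¹D_nQ(a·n)`: the ONLY place the rungs enter `γ`. All Props here are predicates used as
hypotheses — none is asserted (D-0026).
-/

noncomputable section

open Finset MeasureTheory Set Filter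
open scoped Topology Pointwise

namespace Summit.KontsevichZagierPeriods.Zeta5Search.Barrier.ConeGamma

open Literature.NumberTheory.Irrationality.BrownZudilin2022 (hList)

/-! ### The accounting rungs as NAMED HYPOTHESES (integer directions) and what they buy

Nothing below is asserted: `Law28`, `Law30` are the ARITHMETIC hypotheses the coordinator named (BZ's (28) is an
«experimental observation»; the tree proves instances ray by ray — `RecordRay*`, `RayC1*`, `RayC5*`, …);
`RatesIdentified` and `DenominatorRate` are the two ANALYTIC identifications (BZ §5 recipe; PNT) that turn the
closed-form rates into statements about the actual sequences. `exponent_of_accounting` shows these four are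
EXACTLY what makes `gamma` the exponent of the explicit approximations — and nothing else enters. -/

/-- The ray `a·n` of an integer direction. -/
def scaleDir (n : ℕ) (a : Fin 8 → ℤ) : Fin 8 → ℤ := fun i => (n : ℤ) * a i

/-- `m_{k+1}(a)`, `k < 5`: the `k`-th largest element of the integer 28-multiset `h(a)` (junk `0` out of range). -/
def mIdx (a : Fin 8 → ℤ) (k : ℕ) : ℤ := (((hList a).insertionSort (· ≤ ·)).reverse).getD k 0

/-- **`D_n(a) = d_{m₁n} d_{m₂n} d_{m₃n} d_{m₄n} d_{m₅n}`**, `d_N = lcm(1,…,N)` — BZ's denominator of (28). -/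
def D28 (a : Fin 8 → ℤ) (n : ℕ) : ℕ := ∏ k : Fin 5, Nat.lcmUpto ((mIdx a k).toNat * n)

/-- **`Φ_n(a) = ∏_{√(m₁n) < p ≤ m₁n} p^{ν_p}`** with `ν_p = N_a(n/p)` — BZ (29)–(30) (for `p > √(m₁n)` Legendre's
formula is the single term `⌊h_i n/p⌋`, so `ν_p = max_σ ord_p(∏_F h_i!/∏_F (σh)_i!) = N_a(n/p)`; primes `p > m₁n`
have `ν_p = 0` and are omitted). -/
def PhiN (a : Fin 8 → ℤ) (n : ℕ) : ℕ :=
  ∏ p ∈ (Finset.range ((mIdx a 0).toNat * n + 1)).filter (fun p => p.Prime ∧ (mIdx a 0).toNat * n < p * p),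
    p ^ (savingN (realDir a) ((n : ℝ) / p)).toNat

/-- `D_n(a) ≥ 1`. -/
theorem D28_pos (a : Fin 8 → ℤ) (n : ℕ) : 0 < D28 a n :=
  Finset.prod_pos fun _ _ => Nat.lcmUpto_pos _

/-- `Φ_n(a) ≥ 1`. -/
theorem PhiN_pos (a : Fin 8 → ℤ) (n : ℕ) : 0 < PhiN a n := by
  unfold PhiN
  refine Finset.prod_pos fun p hp => ?_
  have hp' := (Finset.mem_filter.mp hp).2.1
  exact pow_pos hp'.pos _

open Literature.NumberTheory.Irrationality.BrownZudilin2022 (cellularIntegral QOf worthiness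
  abs_sub_div_lt_of_rates)
open Literature.NumberTheory.Transcendental (zetaValue)

/-- `P : ℕ → ℚ` is a choice of RATIONAL PARTS along the ray of `a`: for every `n ≥ 1` there is `P̂ ∈ ℚ` with
`I(a·n) = Q(a·n)(2ζ(5) + 4ζ(3)ζ(2)) − 4P̂ζ(2) − 2P(n)` — the decomposition (4) in the shape of the tree's existential
named fact `BrownZudilin2022.decomposition` (BZ print no formula for `P`; the cell's determinant dictionary is NOT
used here). Then `I′(a·n) = Q(a·n)ζ(5) − P(n)`. -/
def IsZeta5Part (a : Fin 8 → ℤ) (P : ℕ → ℚ) : Prop :=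
  ∀ n : ℕ, 1 ≤ n → ∃ Phat : ℚ,
    cellularIntegral (scaleDir n a) =
      (QOf (scaleDir n a) : ℝ) * (2 * zetaValue 5 + 4 * zetaValue 3 * zetaValue 2)
        - 4 * (Phat : ℝ) * zetaValue 2 - 2 * (P n : ℝ)

/-- **`Law28`** — BZ22 (28) along the ray of `a` for the rational parts `P` («experimental observation», p. 20):
`d_{m₁n}⋯d_{m₅n} · I′(a·n) ∈ ℤζ(5) + ℤ`, i.e. `D_n(a)·P(n) ∈ ℤ` (`D_n Q ∈ ℤ` being automatic). NAMED HYPOTHESIS. -/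
def Law28 (a : Fin 8 → ℤ) (P : ℕ → ℚ) : Prop :=
  ∀ n : ℕ, 1 ≤ n → ∃ z : ℤ, (D28 a n : ℚ) * P n = z

/-- **`Law30`** — BZ22 (30): `Φ_n(a)⁻¹ · d_{m₁n}⋯d_{m₅n} · I′(a·n) ∈ ℤζ(5) + ℤ`, i.e. BOTH `Φ_n⁻¹D_n·Q(a·n) ∈ ℤ` and
`Φ_n⁻¹D_n·P(n) ∈ ℤ` (the `S₇` saving rides on (28) through the `G`-relations of §7). NAMED HYPOTHESIS. -/
def Law30 (a : Fin 8 → ℤ) (P : ℕ → ℚ) : Prop :=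
  ∀ n : ℕ, 1 ≤ n →
    (∃ z : ℤ, ((D28 a n : ℚ) / PhiN a n) * QOf (scaleDir n a) = z)
    ∧ ∃ z : ℤ, ((D28 a n : ℚ) / PhiN a n) * P n = z

/-- (30) contains (28). -/
theorem law28_of_law30 {a : Fin 8 → ℤ} {P : ℕ → ℚ} (h : Law30 a P) : Law28 a P := by
  intro n hn
  obtain ⟨z, hz⟩ := (h n hn).2
  refine ⟨(PhiN a n : ℤ) * z, ?_⟩
  have hΦ : (PhiN a n : ℚ) ≠ 0 := by exact_mod_cast (PhiN_pos a n).ne'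
  push_cast
  rw [← hz]
  field_simp

/-- **`RatesIdentified`** — BZ's §5 recipe (Poincaré–Perron-type identification of critical values with growth
rates, together with the non-vanishing of Remark 2): along the ray, `(1/n) log|Q(a·n)| → C₁(a)`,
`(1/n) log|Q(a·n)ζ(5) − P(n)| → C₀(a)`, and both sequences are eventually non-zero. NAMED HYPOTHESIS (the record
ray's printed instance is the Literature fact `BrownZudilin2022.record_rates`; not proved in the tree). -/
def RatesIdentified (a : Fin 8 → ℤ) (P : ℕ → ℚ) : Prop :=
  Tendsto (fun n : ℕ => Real.log |(QOf (scaleDir n a) : ℝ)| / n) atTop (𝓝 (C1 (realDir a)))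
  ∧ Tendsto (fun n : ℕ => Real.log |(QOf (scaleDir n a) : ℝ) * zetaValue 5 - (P n : ℝ)| / n) atTop
      (𝓝 (C0 (realDir a)))
  ∧ ∀ᶠ n : ℕ in atTop, (QOf (scaleDir n a) : ℝ) ≠ 0 ∧ (QOf (scaleDir n a) : ℝ) * zetaValue 5 - (P n : ℝ) ≠ 0

/-- **`DenominatorRate`** — ANALYTIC (a theorem in principle: the PNT `log d_N ∼ N`, in the tree as
`Literature.NumberTheory.Transcendental.tendsto_log_lcmUpto_div`, gives `(1/n) log D_n → δ₂₈`; the `Φ_n` half is a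
PNT-with-breakpoints argument; NEITHER is proved here): `(1/n) log (D_n(a)/Φ_n(a)) → δ₂₈(a) − Φ(a)`. -/
def DenominatorRate (a : Fin 8 → ℤ) : Prop :=
  Tendsto (fun n : ℕ => Real.log ((D28 a n : ℝ) / PhiN a n) / n) atTop
    (𝓝 (delta28 (realDir a) - phi30 (realDir a)))


/-- **The `D_n` half of `DenominatorRate` is the prime number theorem** (tree:
`Literature.NumberTheory.Transcendental.tendsto_log_lcmUpto_div`, `log d_N / N → 1`):
`(1/n) log D_n(a) → m₁ + m₂ + m₃ + m₄ + m₅` (as naturals `(mIdx a k).toNat`; for `a` in the cone the `m_k` are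
`≥ 0`). What remains of `DenominatorRate` after this is the `Φ_n` half (PNT with breakpoints) and the bookkeeping
identity `delta28 (realDir a) = Σ_k mIdx a k` (sum of the five largest = max over 5-subsets), neither proved here. -/
theorem tendsto_log_D28_div (a : Fin 8 → ℤ) :
    Tendsto (fun n : ℕ => Real.log (D28 a n) / n) atTop (𝓝 (∑ k : Fin 5, ((mIdx a k).toNat : ℝ))) := by
  have hterm : ∀ k : Fin 5, Tendsto (fun n : ℕ => Real.log (Nat.lcmUpto ((mIdx a k).toNat * n)) / n) atTop
      (𝓝 ((mIdx a k).toNat : ℝ)) := by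
    intro k
    rcases Nat.eq_zero_or_pos (mIdx a k).toNat with h0 | hpos
    · rw [h0]
      simp only [zero_mul, Nat.cast_zero]
      have : (fun n : ℕ => Real.log (Nat.lcmUpto 0 : ℕ) / (n : ℝ)) = fun _ => 0 := by
        ext n; simp [Nat.lcmUpto]
      rw [this]
      exact tendsto_const_nhds
    · -- `log d_{cn}/n = c · (log d_{cn}/(cn))` and `cn → ∞`
      set c := (mIdx a k).toNat with hc
      have h := (Literature.NumberTheory.Transcendental.tendsto_log_lcmUpto_div.comp
        (tendsto_id.const_mul_atTop' hpos)).const_mul (c : ℝ)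
      rw [mul_one] at h
      refine h.congr' ?_
      filter_upwards [eventually_ge_atTop 1] with n hn
      simp only [Function.comp_apply, id]
      have hn0 : (n : ℝ) ≠ 0 := by exact_mod_cast (show n ≠ 0 by omega)
      have hc0 : (c : ℝ) ≠ 0 := by exact_mod_cast hpos.ne'
      push_cast
      field_simp
  have hsum := tendsto_finsetSum (Finset.univ : Finset (Fin 5)) fun k _ => hterm k
  refine hsum.congr' ?_
  filter_upwards with n
  unfold D28
  rw [Nat.cast_prod, Real.log_prod, Finset.sum_div]
  intro k _
  exact_mod_cast (Nat.lcmUpto_pos _).ne'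

/-- The explicit approximations: `q_n = Φ_n⁻¹ D_n Q(a·n)`, `p_n = Φ_n⁻¹ D_n P(n)`. -/
def approxQ (a : Fin 8 → ℤ) (n : ℕ) : ℝ := (D28 a n : ℝ) / PhiN a n * QOf (scaleDir n a)

/-- See `approxQ`. -/
def approxP (a : Fin 8 → ℤ) (P : ℕ → ℚ) (n : ℕ) : ℝ := (D28 a n : ℝ) / PhiN a n * P n

/-- Under `Law30` the approximations are INTEGERS. -/
theorem approx_int {a : Fin 8 → ℤ} {P : ℕ → ℚ} (h : Law30 a P) {n : ℕ} (hn : 1 ≤ n) :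
    (∃ z : ℤ, approxQ a n = z) ∧ ∃ z : ℤ, approxP a P n = z := by
  obtain ⟨⟨zq, hq⟩, ⟨zp, hp⟩⟩ := h n hn
  refine ⟨⟨zq, ?_⟩, ⟨zp, ?_⟩⟩
  · unfold approxQ
    have h := congrArg (fun r : ℚ => (r : ℝ)) hq
    simp only [Rat.cast_mul, Rat.cast_div, Rat.cast_natCast, Rat.cast_intCast] at h
    exact h
  · unfold approxP
    have h := congrArg (fun r : ℚ => (r : ℝ)) hp
    simp only [Rat.cast_mul, Rat.cast_div, Rat.cast_natCast, Rat.cast_intCast] at h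
    exact h

/-- `γ` IS a worthiness: `γ(a) = worthiness (C₀ + C₂) (C₁ + C₂)`, `C₂ = δ₂₈ − Φ` (BZ §11 «we can apply the
calculation from Section 2 with c₀ = C₀ + C₂, c₁ = C₁ + C₂»). -/
theorem gamma_eq_worthiness (a : Dir) :
    gamma a = worthiness (C0 a + (delta28 a - phi30 a)) (C1 a + (delta28 a - phi30 a)) := by
  unfold gamma worthiness
  congr 1 <;> ring

/-- **The accounting ⇒ the exponent (where the rungs enter).** For an integer direction with rational parts `P`:
`Law30` (hence `Law28`), the identification of rates, the denominator rate and `C₁ + δ₂₈ − Φ > 0` give, for every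
`ε > 0` and all large `n`, `|ζ(5) − p_n/q_n| < q_n^{−(γ(a) − ε)}` for the INTEGERS `p_n = Φ_n⁻¹D_nP(n)`,
`q_n = Φ_n⁻¹D_nQ(a·n)` — BZ's worthiness recipe `BrownZudilin2022.abs_sub_div_lt_of_rates`. No irrationality
content unless `γ > 1` (never observed). -/
theorem exponent_of_accounting {a : Fin 8 → ℤ} {P : ℕ → ℚ}
    (hR : RatesIdentified a P) (hD : DenominatorRate a)
    (hpos : 0 < C1 (realDir a) + delta28 (realDir a) - phi30 (realDir a)) {ε : ℝ} (hε : 0 < ε) :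
    ∀ᶠ n : ℕ in atTop,
      |zetaValue 5 - approxP a P n / approxQ a n| < 1 / |approxQ a n| ^ (gamma (realDir a) - ε) := by
  obtain ⟨hQ, hL, hne⟩ := hR
  have hDpos : ∀ n, 0 < (D28 a n : ℝ) / PhiN a n := fun n =>
    div_pos (by exact_mod_cast D28_pos a n) (by exact_mod_cast PhiN_pos a n)
  -- the two rates of the normalised sequences
  have h1 : Tendsto (fun n : ℕ => Real.log |approxQ a n| / n) atTop
      (𝓝 (C1 (realDir a) + (delta28 (realDir a) - phi30 (realDir a)))) := by
    rw [add_comm]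
    refine (hD.add hQ).congr' ?_
    filter_upwards [hne] with n hn
    rw [← add_div, approxQ, abs_mul, abs_of_pos (hDpos n), Real.log_mul (hDpos n).ne' (abs_ne_zero.mpr hn.1)]
  have h0 : Tendsto (fun n : ℕ => Real.log |approxQ a n * zetaValue 5 - approxP a P n| / n) atTop
      (𝓝 (C0 (realDir a) + (delta28 (realDir a) - phi30 (realDir a)))) := by
    rw [add_comm]
    refine (hD.add hL).congr' ?_
    filter_upwards [hne] with n hn
    rw [← add_div, approxQ, approxP, show (D28 a n : ℝ) / PhiN a n * QOf (scaleDir n a) * zetaValue 5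
        - (D28 a n : ℝ) / PhiN a n * P n
        = (D28 a n : ℝ) / PhiN a n * ((QOf (scaleDir n a) : ℝ) * zetaValue 5 - P n) by ring,
      abs_mul, abs_of_pos (hDpos n), Real.log_mul (hDpos n).ne' (abs_ne_zero.mpr hn.2)]
  have hpos' : 0 < C1 (realDir a) + (delta28 (realDir a) - phi30 (realDir a)) := by linarith
  have key := abs_sub_div_lt_of_rates h0 h1 hpos' hε
  rw [← gamma_eq_worthiness] at key
  exact key


/-! ### (28)/(30) up to a fixed cofactor (lead/lit g22 WORDING NOTE 2026-08-23; engine-d2 C-D2-11)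

On the exact rows of the cell, (28) ALONE is short only at `p ∈ {2,3}` — on 13 + 34 of 892 regular directions, by
at most `2` resp. `1` (`p = 5, 7` never; `p ≥ 11` only on the MID edge) — so a cofactor `c = 12` fits every regular row
on disk (`n ≤ 40`) and `c = 1` fits the record / TOP_STAIR #1 / flag rays through `n = 60` (engine-d2 g3, table
`LAW28-SMALLPRIMES-n60.json`; numbers, not a proof). The lead's typing rule: state (28) «asymptotically / up to a
fixed cofactor supported on `{2,3}`». A FIXED cofactor changes no rate, so `γ` and `exponent_of_accounting` are
unaffected; the `c = 1` case is `Law28`/`Law30` above (kept byte-identical). -/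

/-- **`Law28c`** — BZ (28) along the ray of `a` UP TO A FIXED COFACTOR: `∃ c ≥ 1, ∀ n ≥ 1, c·D_n(a)·P(n) ∈ ℤ`.
NAMED HYPOTHESIS (the form the exact rows support at the primes `2, 3`). -/
def Law28c (a : Fin 8 → ℤ) (P : ℕ → ℚ) : Prop :=
  ∃ c : ℕ, 0 < c ∧ ∀ n : ℕ, 1 ≤ n → ∃ z : ℤ, (c : ℚ) * (D28 a n : ℚ) * P n = z

/-- **`Law30c`** — BZ (30) up to the same kind of fixed cofactor: `∃ c ≥ 1, ∀ n ≥ 1, c·Φ_n⁻¹D_n·Q(a·n) ∈ ℤ ∧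
c·Φ_n⁻¹D_n·P(n) ∈ ℤ`. NAMED HYPOTHESIS. -/
def Law30c (a : Fin 8 → ℤ) (P : ℕ → ℚ) : Prop :=
  ∃ c : ℕ, 0 < c ∧ ∀ n : ℕ, 1 ≤ n →
    (∃ z : ℤ, (c : ℚ) * ((D28 a n : ℚ) / PhiN a n) * QOf (scaleDir n a) = z)
    ∧ ∃ z : ℤ, (c : ℚ) * ((D28 a n : ℚ) / PhiN a n) * P n = z

/-- `Law28` is the case `c = 1` of `Law28c`. -/
theorem law28c_of_law28 {a : Fin 8 → ℤ} {P : ℕ → ℚ} (h : Law28 a P) : Law28c a P := by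
  refine ⟨1, one_pos, fun n hn => ?_⟩
  obtain ⟨z, hz⟩ := h n hn
  exact ⟨z, by rw [Nat.cast_one, one_mul]; exact hz⟩

/-- `Law30` is the case `c = 1` of `Law30c`. -/
theorem law30c_of_law30 {a : Fin 8 → ℤ} {P : ℕ → ℚ} (h : Law30 a P) : Law30c a P := by
  refine ⟨1, one_pos, fun n hn => ?_⟩
  obtain ⟨⟨zq, hq⟩, ⟨zp, hp⟩⟩ := h n hn
  exact ⟨⟨zq, by rw [Nat.cast_one, one_mul]; exact hq⟩, ⟨zp, by rw [Nat.cast_one, one_mul]; exact hp⟩⟩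

/-- `Law30c` contains `Law28c` (multiply by `Φ_n ∈ ℕ`). -/
theorem law28c_of_law30c {a : Fin 8 → ℤ} {P : ℕ → ℚ} (h : Law30c a P) : Law28c a P := by
  obtain ⟨c, hc, hall⟩ := h
  refine ⟨c, hc, fun n hn => ?_⟩
  obtain ⟨z, hz⟩ := (hall n hn).2
  refine ⟨(PhiN a n : ℤ) * z, ?_⟩
  have hΦ : (PhiN a n : ℚ) ≠ 0 := by exact_mod_cast (PhiN_pos a n).ne'
  push_cast
  rw [← hz]
  field_simp

/-- Under `Law30c` the approximations scaled by the cofactor are INTEGERS: `c·q_n, c·p_n ∈ ℤ` — and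
`(c p_n)/(c q_n) = p_n/q_n`, so `exponent_of_accounting` applies verbatim to them. -/
theorem approx_int_c {a : Fin 8 → ℤ} {P : ℕ → ℚ} (h : Law30c a P) :
    ∃ c : ℕ, 0 < c ∧ ∀ n : ℕ, 1 ≤ n →
      (∃ z : ℤ, (c : ℝ) * approxQ a n = z) ∧ ∃ z : ℤ, (c : ℝ) * approxP a P n = z := by
  obtain ⟨c, hc, hall⟩ := h
  refine ⟨c, hc, fun n hn => ?_⟩
  obtain ⟨⟨zq, hq⟩, ⟨zp, hp⟩⟩ := hall n hn
  refine ⟨⟨zq, ?_⟩, ⟨zp, ?_⟩⟩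
  · unfold approxQ
    have h := congrArg (fun r : ℚ => (r : ℝ)) hq
    simp only [Rat.cast_mul, Rat.cast_div, Rat.cast_natCast, Rat.cast_intCast] at h
    rw [← h]; ring
  · unfold approxP
    have h := congrArg (fun r : ℚ => (r : ℝ)) hp
    simp only [Rat.cast_mul, Rat.cast_div, Rat.cast_natCast, Rat.cast_intCast] at h
    rw [← h]; ring

end Summit.KontsevichZagierPeriods.Zeta5Search.Barrier.ConeGamma

end
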